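import Literature.Computability.AlgebraicComplexity.MS21MultilinearHassePolarisation
import Literature.Computability.AlgebraicComplexity.MS21ANFSeparation
import HarnessLib

/-!
# Leibniz rules for Hasse derivatives and the top addition gate of `ANF_{Δ+1}` (B36 toolkit,
# stage S2b; cell `val-lit`, seat t18 g5)

Theorem-only file. Blueprint v2 `HOME/np/t18g5-MS21-thm35-B36-hasse-blueprint.md` (§v2: the
AGGREGATED form of the ANF structure lemma for the characteristic-free repair of
[MediniShpilka2021, Lemma 5.13 (arXiv:2102.05632 p0029:L3-L26)], registry item B36). Two generic
ingredients of its induction step `Δ → Δ+1` (`ANF_{Δ+1} = A₀A₁ + A₂A₃`, Def 8):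

* `MS2021.hasseD_one_mul`, `MS2021.hasseD_two_mul` — Leibniz rules
  `Δ¹_u(fg) = Δ¹_u f·g + f·Δ¹_u g`, `Δ²_u(fg) = Δ²_u f·g + Δ¹_u f·Δ¹_u g + f·Δ²_u g` (every
  characteristic; `taylorAlong` is an algebra map), used to split `Δ²_c (A₀A₁ + A₂A₃)` into its six
  block-bihomogeneous pieces;
* `MS2021.exists_pderiv_pderiv_anf_succ_eq_zero_of_union_eq_univ` — the top gate of `ANF_{Δ+1}` is
  an ADDITION gate between the halves `{x^{(0)},x^{(1)}}` and `{x^{(2)},x^{(3)}}` (seat p1 g5's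
  `pderiv_pderiv_anf_succ_other`), hence any two non-empty sets of variables covering all of them
  contain a pair `k ∈ S`, `l ∈ S'` with `∂_k∂_l ANF_{Δ+1} = 0` — the combinatorial fact that forces
  the column supports of the row blocks of a "bad" change of basis `M` to be whole quarters.

No definitions, no facts (D-0026). HONEST FRAMING: toolkit towards a characteristic-free proof of a
2021 published lemma; `VP ≠ VNP` is NOT proved and nothing here bears on it.

## References
* [MediniShpilka2021] D. Medini, A. Shpilka, CCC 2021 (LIPIcs 200:19) = arXiv:2102.05632: Def 8
  (ANF), Obs 5.8 (p0025:L57-L60), Lemma 5.13 (p0029:L3-L26), Def 3.6 (p0017:L44-L49).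
-/

noncomputable section

open MvPolynomial

namespace Literature.Computability.AlgebraicComplexity

namespace MS2021

section Leibniz

variable {K : Type*} [CommRing K] {σ : Type*}

/-- **Leibniz rule, first order**: `Δ¹_u(fg) = Δ¹_u f · g + f · Δ¹_u g` (with `Δ⁰ = id`).
[cite: MediniShpilka2021, Def 3.6 (arXiv p0017:L44-L49)] -/
theorem hasseD_one_mul (u : σ → K) (f g : MvPolynomial σ K) :
    hasseD 1 u (f * g) = hasseD 1 u f * g + f * hasseD 1 u g := by
  rw [hasseD, map_mul, Polynomial.coeff_mul, Finset.Nat.antidiagonal_succ, Finset.sum_cons,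
    Finset.Nat.antidiagonal_zero, Finset.map_singleton, Finset.sum_singleton]
  change hasseD 0 u f * hasseD (0 + 1) u g + hasseD _ u f * hasseD _ u g = _
  simp only [hasseD_zero, zero_add, Function.Embedding.coe_prodMap, Function.Embedding.coeFn_mk,
    Prod.map, Nat.succ_eq_add_one, Function.Embedding.refl_apply]
  rw [add_comm]

/-- **Leibniz rule, second order**: `Δ²_u(fg) = Δ²_u f · g + Δ¹_u f · Δ¹_u g + f · Δ²_u g`
(coefficient of `z²` in `f(x+zu) g(x+zu)`; no factor `2`, every characteristic).
[cite: MediniShpilka2021, Def 3.6 (arXiv p0017:L44-L49) and proof of Lemma 5.13 (p0029:L12-L14)] -/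
theorem hasseD_two_mul (u : σ → K) (f g : MvPolynomial σ K) :
    hasseD 2 u (f * g) = hasseD 2 u f * g + hasseD 1 u f * hasseD 1 u g + f * hasseD 2 u g := by
  rw [hasseD, map_mul, Polynomial.coeff_mul, Finset.Nat.sum_antidiagonal_eq_sum_range_succ_mk,
    Finset.sum_range_succ, Finset.sum_range_succ, Finset.sum_range_succ, Finset.sum_range_zero,
    zero_add]
  change hasseD 0 u f * hasseD (2 - 0) u g + hasseD 1 u f * hasseD (2 - 1) u g +
    hasseD 2 u f * hasseD (2 - 2) u g = _
  rw [hasseD_zero, Nat.sub_zero, show 2 - 1 = 1 from rfl, Nat.sub_self, hasseD_zero]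
  ring

end Leibniz

section TopGate

variable (K : Type*) [Field K]

/-- Across the two halves of `ANF_{Δ+1} = A₀A₁ + A₂A₃` the first common gate is the top ADDITION
gate: `∂_{x^{(b)}_j} ∂_{x^{(b')}_{j'}} ANF_{Δ+1} = 0` for `b ∈ {0,1}`, `b' ∈ {2,3}` (either order).
[cite: MediniShpilka2021, Obs 5.8 and proof of Lemma 5.13 (arXiv p0025:L57-L60, p0029:L13)] -/
theorem pderiv_pderiv_anf_succ_cross (Δ : ℕ) {b b' : Fin 4} (hb : b = 0 ∨ b = 1)
    (hb' : b' = 2 ∨ b' = 3) (j j' : Fin (4 ^ Δ)) :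
    pderiv (anfBlock Δ b' j') (pderiv (anfBlock Δ b j) (anf K (Δ + 1))) = 0 ∧
      pderiv (anfBlock Δ b j) (pderiv (anfBlock Δ b' j') (anf K (Δ + 1))) = 0 := by
  constructor
  · refine pderiv_pderiv_anf_succ_other K Δ ?_ ?_ j j'
    · rcases hb with rfl | rfl <;> rcases hb' with rfl | rfl <;> decide
    · rcases hb with rfl | rfl <;> rcases hb' with rfl | rfl <;> decide
  · refine pderiv_pderiv_anf_succ_other K Δ ?_ ?_ j' j
    · rcases hb with rfl | rfl <;> rcases hb' with rfl | rfl <;> decide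
    · rcases hb with rfl | rfl <;> rcases hb' with rfl | rfl <;> decide

/-- **The top gate is an addition gate**: if two NON-EMPTY sets of variables of `ANF_{Δ+1}` together
cover all variables, some `k ∈ S`, `l ∈ S'` have `∂_k ∂_l ANF_{Δ+1} = 0` (a pair across the two
halves exists). In the structure lemma this forbids a row block of a "bad" `M` from being supported on
a proper part of a quarter. [cite: MediniShpilka2021, Obs 5.8 and Lemma 5.13 (arXiv p0025:L57-L60, p0029:L13)] -/
theorem exists_pderiv_pderiv_anf_succ_eq_zero_of_union_eq_univ (Δ : ℕ)
    {S S' : Finset (Fin (4 ^ (Δ + 1)))} (hS : S.Nonempty) (hS' : S'.Nonempty)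
    (hcov : S ∪ S' = Finset.univ) :
    ∃ k ∈ S, ∃ l ∈ S', pderiv k (pderiv l (anf K (Δ + 1))) = 0 := by
  classical
  have hmem : ∀ v : Fin (4 ^ (Δ + 1)), v ∈ S ∨ v ∈ S' := fun v => by
    have : v ∈ S ∪ S' := hcov ▸ Finset.mem_univ v
    exact Finset.mem_union.1 this
  have j₀ : Fin (4 ^ Δ) := ⟨0, Nat.pos_of_ne_zero (pow_ne_zero _ (by norm_num))⟩
  -- one variable in the first half, one in the second half
  set a : Fin (4 ^ (Δ + 1)) := anfBlock Δ 0 j₀ with ha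
  set a' : Fin (4 ^ (Δ + 1)) := anfBlock Δ 2 j₀ with ha'
  have haa' : pderiv a (pderiv a' (anf K (Δ + 1))) = 0 ∧ pderiv a' (pderiv a (anf K (Δ + 1))) = 0 :=
    ⟨(pderiv_pderiv_anf_succ_cross K Δ (Or.inl rfl) (Or.inl rfl) j₀ j₀).2,
      (pderiv_pderiv_anf_succ_cross K Δ (Or.inl rfl) (Or.inl rfl) j₀ j₀).1⟩
  -- any variable pairs with `a` or with `a'` across the top gate
  have hany : ∀ v : Fin (4 ^ (Δ + 1)),
      (pderiv v (pderiv a' (anf K (Δ + 1))) = 0 ∧ pderiv a' (pderiv v (anf K (Δ + 1))) = 0) ∨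
      (pderiv v (pderiv a (anf K (Δ + 1))) = 0 ∧ pderiv a (pderiv v (anf K (Δ + 1))) = 0) := by
    intro v
    obtain ⟨b, j, rfl⟩ := exists_eq_anfBlock Δ v
    have hb4 : b = 0 ∨ b = 1 ∨ b = 2 ∨ b = 3 := by
      rcases b with ⟨b, hb⟩
      have : b = 0 ∨ b = 1 ∨ b = 2 ∨ b = 3 := by omega
      rcases this with rfl | rfl | rfl | rfl
      · exact Or.inl rfl
      · exact Or.inr (Or.inl rfl)
      · exact Or.inr (Or.inr (Or.inl rfl))
      · exact Or.inr (Or.inr (Or.inr rfl))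
    rcases hb4 with hb | hb | hb | hb
    · left
      have h := pderiv_pderiv_anf_succ_cross K Δ (b := b) (b' := 2) (Or.inl hb) (Or.inl rfl) j j₀
      exact ⟨h.2, h.1⟩
    · left
      have h := pderiv_pderiv_anf_succ_cross K Δ (b := b) (b' := 2) (Or.inr hb) (Or.inl rfl) j j₀
      exact ⟨h.2, h.1⟩
    · right
      have h := pderiv_pderiv_anf_succ_cross K Δ (b := 0) (b' := b) (Or.inl rfl) (Or.inl hb) j₀ j
      exact ⟨h.1, h.2⟩
    · right
      have h := pderiv_pderiv_anf_succ_cross K Δ (b := 0) (b' := b) (Or.inl rfl) (Or.inr hb) j₀ j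
      exact ⟨h.1, h.2⟩
  rcases hmem a with haS | haS' <;> rcases hmem a' with ha'S | ha'S'
  · -- `a, a' ∈ S`: pair some `l ∈ S'` with whichever of `a, a'` lies across the gate
    obtain ⟨l, hl⟩ := hS'
    rcases hany l with h | h
    · exact ⟨a', ha'S, l, hl, h.2⟩
    · exact ⟨a, haS, l, hl, h.2⟩
  · exact ⟨a, haS, a', ha'S', haa'.1⟩
  · exact ⟨a', ha'S, a, haS', haa'.2⟩
  · obtain ⟨k, hk⟩ := hS
    rcases hany k with h | h
    · exact ⟨k, hk, a', ha'S', h.1⟩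
    · exact ⟨k, hk, a, haS', h.1⟩

end TopGate

end MS2021

end Literature.Computability.AlgebraicComplexity
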